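import Mathlib

/-!
# PercRepro — the case-1 finite check of the good-target rule's column bound, in the type-count model (night-2, gen 29)

The column bound at a one-coloop target with three good sources `y₁, y₂, y₃` (proofs/NIGHT-2-g29.md §4′(c), §4‴) reduces
to an inequality in the TYPE COUNTS of the outside points: an outside point lies in the closure `H` of the face at the
coloop or not, and in at most one or in all three of the face closures `H′_a` (Night2OneFatCaseOneGeomB); with
`n_a` = the points of `H` in `H′_a` only, `n₀` = the points of `H` in no `H′_a`, `z_a` = the points off `H` in `H′_a` only,
`z₀` = the points off `H` in no `H′_a`, `zA` = the points off `H` in all three: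
`m_H = 1 + z₀ + z₁ + z₂ + z₃ + zA` (the missed points of `H`: the coloop and the points off `H`),
`m_a = 2 + (n₀ + n_b + n_c) + (z₀ + z_b + z_c)` (the missed points of `H′_a`: `y_b, y_c` and the outside points not in `H′_a`),
`g_a = 1 + n_a + n₀ + z₀ + z₁ + z₂ + z₃` (the good points of the source `y_a`: itself and the outside points in at most
one of its three face closures).  The requests are `r = Φ/(m + 2) ≤ 7/30` for `m ≥ 3`, and for `m = 2` either `7/24`
(the unique fat closure) or `0` (a non-member face); the loss of the source `y_a` is `(r_H + r_b + r_c − 11/18)⁺`, split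
over its `g_a` good points; the capacity is `11/18 − r_H`.

**`caseOne_finite_check`**: for all counts and all admissible requests with at most one request equal to `7/24`,
`Σ_a (r_H + r_b + r_c − 11/18)⁺ / g_a ≤ 11/18 − r_H`.  The proof is the case analysis of §4‴ L7: no fat request (each
loss `≤ 32/360`); `H` fat (then exactly one point off `H`, and at most one source with a single good point unless two of
the `H′` are fat non-members, whose losses vanish); some `H′_a` fat (then `g_a ≥ 2` or every loss vanishes).
-/

namespace PercRepro.Shadow

/-- The admissible request of a face with `m` missed points: `7/24` (fat member), `0` (fat non-member) or `≤ 7/30`. -/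
def AdmissibleReq (m : ℕ) (r : ℚ) : Prop :=
  0 ≤ r ∧ (m = 2 → r = 0 ∨ r = 7 / 24) ∧ (3 ≤ m → r ≤ 7 / 30)

/-- An admissible request is nonnegative. -/
theorem AdmissibleReq.nonneg {m : ℕ} {r : ℚ} (h : AdmissibleReq m r) : 0 ≤ r := h.1

/-- An admissible request is at most the fat request `7/24`. -/
theorem AdmissibleReq.le_fat {m : ℕ} {r : ℚ} (h : AdmissibleReq m r) (hm : 2 ≤ m) : r ≤ 7 / 24 := by
  rcases h with ⟨-, h2, h3⟩
  rcases Nat.lt_or_ge m 3 with hlt | hge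
  · rcases h2 (by omega) with rfl | rfl
    · norm_num
    · exact le_refl _
  · have := h3 hge; linarith

/-- An admissible request other than `7/24` is at most `7/30`. -/
theorem AdmissibleReq.le_thin_of_ne {m : ℕ} {r : ℚ} (h : AdmissibleReq m r) (hm : 2 ≤ m) (hne : r ≠ 7 / 24) :
    r ≤ 7 / 30 := by
  rcases h with ⟨-, h2, h3⟩
  rcases Nat.lt_or_ge m 3 with hlt | hge
  · rcases h2 (by omega) with rfl | rfl
    · norm_num
    · exact absurd rfl hne
  · exact h3 hge

/-- The fat request `7/24` occurs only at `m = 2`. -/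
theorem AdmissibleReq.eq_two_of_eq_fat {m : ℕ} {r : ℚ} (h : AdmissibleReq m r) (hm : 2 ≤ m) (hr : r = 7 / 24) :
    m = 2 := by
  by_contra hne
  have := h.2.2 (by omega)
  rw [hr] at this
  norm_num at this

/-- At `m = 2` a request other than `7/24` vanishes (a non-member face). -/
theorem AdmissibleReq.eq_zero_of_two_of_ne {m : ℕ} {r : ℚ} (h : AdmissibleReq m r) (hm : m = 2)
    (hne : r ≠ 7 / 24) : r = 0 := by
  rcases h.2.1 hm with h0 | h0
  · exact h0
  · exact absurd h0 hne

/-- A nonnegative quantity split over `g ≥ 1` points is at most itself. -/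
theorem div_nat_le_self {a : ℚ} (ha : 0 ≤ a) {g : ℕ} (hg : 1 ≤ g) : a / (g : ℚ) ≤ a := by
  have hg' : (1 : ℚ) ≤ (g : ℚ) := by exact_mod_cast hg
  calc a / (g : ℚ) ≤ a / 1 := div_le_div_of_nonneg_left ha (by norm_num) hg'
    _ = a := div_one a

/-- A nonnegative quantity split over `g ≥ 2` points is at most half of itself. -/
theorem div_nat_le_half {a : ℚ} (ha : 0 ≤ a) {g : ℕ} (hg : 2 ≤ g) : a / (g : ℚ) ≤ a / 2 := by
  have hg' : (2 : ℚ) ≤ (g : ℚ) := by exact_mod_cast hg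
  exact div_le_div_of_nonneg_left ha (by norm_num) hg'

/-- `a / g ≤ A` from `0 ≤ a ≤ A` and `g ≥ 1`. -/
theorem div_nat_le_of_le {a A : ℚ} (ha : 0 ≤ a) (haA : a ≤ A) {g : ℕ} (hg : 1 ≤ g) : a / (g : ℚ) ≤ A :=
  (div_nat_le_self ha hg).trans haA

/-- `a / g ≤ A / 2` from `0 ≤ a ≤ A` and `g ≥ 2`. -/
theorem div_nat_le_half_of_le {a A : ℚ} (ha : 0 ≤ a) (haA : a ≤ A) {g : ℕ} (hg : 2 ≤ g) : a / (g : ℚ) ≤ A / 2 :=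
  (div_nat_le_half ha hg).trans (by linarith)

/-- A vanishing quantity contributes nothing. -/
theorem div_nat_eq_zero_of_le_zero {a : ℚ} (ha : 0 ≤ a) (ha' : a ≤ 0) (g : ℕ) : a / (g : ℚ) = 0 := by
  have : a = 0 := le_antisymm ha' ha
  rw [this, zero_div]

/-- The positive part is bounded by any upper bound of the quantity that is itself nonnegative. -/
theorem max_zero_le_of_le {a A : ℚ} (h : a ≤ A) (hA : 0 ≤ A) : max a 0 ≤ A := max_le h hA

section Count

variable {n₀ n₁ n₂ n₃ z₀ z₁ z₂ z₃ zA mH m₁ m₂ m₃ g₁ g₂ g₃ : ℕ} {rH r₁ r₂ r₃ : ℚ}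

/-- The three-term bound with all good-point counts at least `2`. -/
theorem three_halves {a b c A : ℚ} (ha : 0 ≤ a) (hb : 0 ≤ b) (hc : 0 ≤ c) (haA : a ≤ A) (hbA : b ≤ A) (hcA : c ≤ A)
    {g₁ g₂ g₃ : ℕ} (hg₁ : 2 ≤ g₁) (hg₂ : 2 ≤ g₂) (hg₃ : 2 ≤ g₃) :
    a / (g₁ : ℚ) + b / (g₂ : ℚ) + c / (g₃ : ℚ) ≤ 3 * A / 2 := by
  have t₁ := div_nat_le_half_of_le ha haA hg₁
  have t₂ := div_nat_le_half_of_le hb hbA hg₂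
  have t₃ := div_nat_le_half_of_le hc hcA hg₃
  linarith

/-- One single good point (first term), two counts at least `2`. -/
theorem one_and_two_halves₁ {a b c A : ℚ} (ha : 0 ≤ a) (hb : 0 ≤ b) (hc : 0 ≤ c) (haA : a ≤ A) (hbA : b ≤ A)
    (hcA : c ≤ A) {g₁ g₂ g₃ : ℕ} (hg₁ : 1 ≤ g₁) (hg₂ : 2 ≤ g₂) (hg₃ : 2 ≤ g₃) :
    a / (g₁ : ℚ) + b / (g₂ : ℚ) + c / (g₃ : ℚ) ≤ 2 * A := by
  have t₁ := div_nat_le_of_le ha haA hg₁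
  have t₂ := div_nat_le_half_of_le hb hbA hg₂
  have t₃ := div_nat_le_half_of_le hc hcA hg₃
  linarith

/-- One single good point (second term), two counts at least `2`. -/
theorem one_and_two_halves₂ {a b c A : ℚ} (ha : 0 ≤ a) (hb : 0 ≤ b) (hc : 0 ≤ c) (haA : a ≤ A) (hbA : b ≤ A)
    (hcA : c ≤ A) {g₁ g₂ g₃ : ℕ} (hg₁ : 2 ≤ g₁) (hg₂ : 1 ≤ g₂) (hg₃ : 2 ≤ g₃) :
    a / (g₁ : ℚ) + b / (g₂ : ℚ) + c / (g₃ : ℚ) ≤ 2 * A := by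
  have t₁ := div_nat_le_half_of_le ha haA hg₁
  have t₂ := div_nat_le_of_le hb hbA hg₂
  have t₃ := div_nat_le_half_of_le hc hcA hg₃
  linarith

/-- One single good point (third term), two counts at least `2`. -/
theorem one_and_two_halves₃ {a b c A : ℚ} (ha : 0 ≤ a) (hb : 0 ≤ b) (hc : 0 ≤ c) (haA : a ≤ A) (hbA : b ≤ A)
    (hcA : c ≤ A) {g₁ g₂ g₃ : ℕ} (hg₁ : 2 ≤ g₁) (hg₂ : 2 ≤ g₂) (hg₃ : 1 ≤ g₃) :
    a / (g₁ : ℚ) + b / (g₂ : ℚ) + c / (g₃ : ℚ) ≤ 2 * A := by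
  have t₁ := div_nat_le_half_of_le ha haA hg₁
  have t₂ := div_nat_le_half_of_le hb hbA hg₂
  have t₃ := div_nat_le_of_le hc hcA hg₃
  linarith

/-- Two vanishing terms (the second and third). -/
theorem one_only₁ {a b c A : ℚ} (ha : 0 ≤ a) (hb : 0 ≤ b) (hc : 0 ≤ c) (haA : a ≤ A) (hb0 : b ≤ 0) (hc0 : c ≤ 0)
    {g₁ g₂ g₃ : ℕ} (hg₁ : 1 ≤ g₁) : a / (g₁ : ℚ) + b / (g₂ : ℚ) + c / (g₃ : ℚ) ≤ A := by
  have t₁ := div_nat_le_of_le ha haA hg₁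
  rw [div_nat_eq_zero_of_le_zero hb hb0 g₂, div_nat_eq_zero_of_le_zero hc hc0 g₃]
  linarith

/-- Two vanishing terms (the first and third). -/
theorem one_only₂ {a b c A : ℚ} (ha : 0 ≤ a) (hb : 0 ≤ b) (hc : 0 ≤ c) (ha0 : a ≤ 0) (hbA : b ≤ A) (hc0 : c ≤ 0)
    {g₁ g₂ g₃ : ℕ} (hg₂ : 1 ≤ g₂) : a / (g₁ : ℚ) + b / (g₂ : ℚ) + c / (g₃ : ℚ) ≤ A := by
  have t₂ := div_nat_le_of_le hb hbA hg₂
  rw [div_nat_eq_zero_of_le_zero ha ha0 g₁, div_nat_eq_zero_of_le_zero hc hc0 g₃]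
  linarith

/-- Two vanishing terms (the first and second). -/
theorem one_only₃ {a b c A : ℚ} (ha : 0 ≤ a) (hb : 0 ≤ b) (hc : 0 ≤ c) (ha0 : a ≤ 0) (hb0 : b ≤ 0) (hcA : c ≤ A)
    {g₁ g₂ g₃ : ℕ} (hg₃ : 1 ≤ g₃) : a / (g₁ : ℚ) + b / (g₂ : ℚ) + c / (g₃ : ℚ) ≤ A := by
  have t₃ := div_nat_le_of_le hc hcA hg₃
  rw [div_nat_eq_zero_of_le_zero ha ha0 g₁, div_nat_eq_zero_of_le_zero hb hb0 g₂]
  linarith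

/-- All three terms with single bounds. -/
theorem three_singles {a b c A : ℚ} (ha : 0 ≤ a) (hb : 0 ≤ b) (hc : 0 ≤ c) (haA : a ≤ A) (hbA : b ≤ A) (hcA : c ≤ A)
    {g₁ g₂ g₃ : ℕ} (hg₁ : 1 ≤ g₁) (hg₂ : 1 ≤ g₂) (hg₃ : 1 ≤ g₃) :
    a / (g₁ : ℚ) + b / (g₂ : ℚ) + c / (g₃ : ℚ) ≤ 3 * A := by
  have t₁ := div_nat_le_of_le ha haA hg₁
  have t₂ := div_nat_le_of_le hb hbA hg₂
  have t₃ := div_nat_le_of_le hc hcA hg₃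
  linarith

set_option maxHeartbeats 800000 in
/-- CASE A of the finite check: `H` is the fat member. -/
theorem caseOne_finite_check_fatH
    (hmH : mH = 1 + (z₀ + z₁ + z₂ + z₃ + zA)) (hZ : 1 ≤ z₀ + z₁ + z₂ + z₃ + zA)
    (hm₁ : m₁ = 2 + (n₀ + n₂ + n₃) + (z₀ + z₂ + z₃)) (hm₂ : m₂ = 2 + (n₀ + n₁ + n₃) + (z₀ + z₁ + z₃))
    (hm₃ : m₃ = 2 + (n₀ + n₁ + n₂) + (z₀ + z₁ + z₂))
    (hg₁ : g₁ = 1 + n₁ + n₀ + (z₀ + z₁ + z₂ + z₃)) (hg₂ : g₂ = 1 + n₂ + n₀ + (z₀ + z₁ + z₂ + z₃))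
    (hg₃ : g₃ = 1 + n₃ + n₀ + (z₀ + z₁ + z₂ + z₃))
    (hH : AdmissibleReq mH rH) (h₁ : AdmissibleReq m₁ r₁) (h₂ : AdmissibleReq m₂ r₂) (h₃ : AdmissibleReq m₃ r₃)
    (hHfat : rH = 7 / 24) (hn1 : r₁ ≠ 7 / 24) (hn2 : r₂ ≠ 7 / 24) (hn3 : r₃ ≠ 7 / 24) :
    max (rH + r₂ + r₃ - 11 / 18) 0 / (g₁ : ℚ) + max (rH + r₁ + r₃ - 11 / 18) 0 / (g₂ : ℚ) +
      max (rH + r₁ + r₂ - 11 / 18) 0 / (g₃ : ℚ) ≤ 11 / 18 - rH := by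
  have hmH_eq : mH = 2 := hH.eq_two_of_eq_fat (by omega) hHfat
  have hZ1 : z₀ + z₁ + z₂ + z₃ + zA = 1 := by omega
  have h1t := h₁.le_thin_of_ne (by omega) hn1
  have h2t := h₂.le_thin_of_ne (by omega) hn2
  have h3t := h₃.le_thin_of_ne (by omega) hn3
  have h10 := h₁.nonneg
  have h20 := h₂.nonneg
  have h30 := h₃.nonneg
  have hL₁0 : 0 ≤ max (rH + r₂ + r₃ - 11 / 18) 0 := le_max_right _ _
  have hL₂0 : 0 ≤ max (rH + r₁ + r₃ - 11 / 18) 0 := le_max_right _ _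
  have hL₃0 : 0 ≤ max (rH + r₁ + r₂ - 11 / 18) 0 := le_max_right _ _
  have hL₁b : max (rH + r₂ + r₃ - 11 / 18) 0 ≤ 53 / 360 :=
    max_zero_le_of_le (by linarith only [hHfat, h2t, h3t]) (by norm_num)
  have hL₂b : max (rH + r₁ + r₃ - 11 / 18) 0 ≤ 53 / 360 :=
    max_zero_le_of_le (by linarith only [hHfat, h1t, h3t]) (by norm_num)
  have hL₃b : max (rH + r₁ + r₂ - 11 / 18) 0 ≤ 53 / 360 :=
    max_zero_le_of_le (by linarith only [hHfat, h1t, h2t]) (by norm_num)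
  have hcap : (11 : ℚ) / 18 - rH = 23 / 72 := by rw [hHfat]; norm_num
  have h1f : m₁ = 2 → r₁ = 0 ∨ r₁ = 7 / 24 := h₁.2.1
  have h2f : m₂ = 2 → r₂ = 0 ∨ r₂ = 7 / 24 := h₂.2.1
  have h3f : m₃ = 2 → r₃ = 0 ∨ r₃ = 7 / 24 := h₃.2.1
  rw [hcap]
  clear hH h₁ h₂ h₃ hmH hmH_eq
  by_cases hzA : zA = 0
  · exact le_trans (three_halves hL₁0 hL₂0 hL₃0 hL₁b hL₂b hL₃b (g₁ := g₁) (g₂ := g₂) (g₃ := g₃)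
      (by omega) (by omega) (by omega)) (by norm_num)
  have hzA1 : zA = 1 := by omega
  have hz : z₀ = 0 ∧ z₁ = 0 ∧ z₂ = 0 ∧ z₃ = 0 := by omega
  obtain ⟨hz0, hz1, hz2, hz3⟩ := hz
  by_cases hn₀ : n₀ = 0
  swap
  · exact le_trans (three_halves hL₁0 hL₂0 hL₃0 hL₁b hL₂b hL₃b (g₁ := g₁) (g₂ := g₂) (g₃ := g₃)
      (by omega) (by omega) (by omega)) (by norm_num)
  by_cases hn₁ : n₁ = 0
  · by_cases hn₂ : n₂ = 0
    · have hm₃eq : m₃ = 2 := by omega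
      have hr₃ : r₃ = 0 := by
        rcases h3f hm₃eq with h | h
        · exact h
        · exact absurd h hn3
      exact le_trans (one_only₃ hL₁0 hL₂0 hL₃0 (max_le (by linarith only [hHfat, hr₃, h2t]) (le_refl _))
        (max_le (by linarith only [hHfat, hr₃, h1t]) (le_refl _)) hL₃b (g₁ := g₁) (g₂ := g₂) (g₃ := g₃)
        (by omega)) (by norm_num)
    · by_cases hn₃ : n₃ = 0
      · have hm₂eq : m₂ = 2 := by omega
        have hr₂ : r₂ = 0 := by
          rcases h2f hm₂eq with h | h
          · exact h
          · exact absurd h hn2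
        exact le_trans (one_only₂ hL₁0 hL₂0 hL₃0 (max_le (by linarith only [hHfat, hr₂, h3t]) (le_refl _)) hL₂b
          (max_le (by linarith only [hHfat, hr₂, h1t]) (le_refl _)) (g₁ := g₁) (g₂ := g₂) (g₃ := g₃)
          (by omega)) (by norm_num)
      · exact le_trans (one_and_two_halves₁ hL₁0 hL₂0 hL₃0 hL₁b hL₂b hL₃b (g₁ := g₁) (g₂ := g₂) (g₃ := g₃)
          (by omega) (by omega) (by omega)) (by norm_num)
  · by_cases hn₂ : n₂ = 0
    · by_cases hn₃ : n₃ = 0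
      · have hm₁eq : m₁ = 2 := by omega
        have hr₁ : r₁ = 0 := by
          rcases h1f hm₁eq with h | h
          · exact h
          · exact absurd h hn1
        exact le_trans (one_only₁ hL₁0 hL₂0 hL₃0 hL₁b (max_le (by linarith only [hHfat, hr₁, h3t]) (le_refl _))
          (max_le (by linarith only [hHfat, hr₁, h2t]) (le_refl _)) (g₁ := g₁) (g₂ := g₂) (g₃ := g₃)
          (by omega)) (by norm_num)
      · exact le_trans (one_and_two_halves₂ hL₁0 hL₂0 hL₃0 hL₁b hL₂b hL₃b (g₁ := g₁) (g₂ := g₂) (g₃ := g₃)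
          (by omega) (by omega) (by omega)) (by norm_num)
    · by_cases hn₃ : n₃ = 0
      · exact le_trans (one_and_two_halves₃ hL₁0 hL₂0 hL₃0 hL₁b hL₂b hL₃b (g₁ := g₁) (g₂ := g₂) (g₃ := g₃)
          (by omega) (by omega) (by omega)) (by norm_num)
      · exact le_trans (three_halves hL₁0 hL₂0 hL₃0 hL₁b hL₂b hL₃b (g₁ := g₁) (g₂ := g₂) (g₃ := g₃)
          (by omega) (by omega) (by omega)) (by norm_num)

set_option maxHeartbeats 800000 in
/-- CASE B′ of the finite check: `H′₁` is the fat member (the other two cases are the same up to renaming). -/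
theorem caseOne_finite_check_fat₁
    (hm₁ : m₁ = 2 + (n₀ + n₂ + n₃) + (z₀ + z₂ + z₃)) (hm₂ : m₂ = 2 + (n₀ + n₁ + n₃) + (z₀ + z₁ + z₃))
    (hm₃ : m₃ = 2 + (n₀ + n₁ + n₂) + (z₀ + z₁ + z₂))
    (hg₁ : g₁ = 1 + n₁ + n₀ + (z₀ + z₁ + z₂ + z₃)) (hg₂1 : 1 ≤ g₂) (hg₃1 : 1 ≤ g₃)
    (hmH2 : 2 ≤ mH)
    (hH : AdmissibleReq mH rH) (h₁ : AdmissibleReq m₁ r₁) (h₂ : AdmissibleReq m₂ r₂) (h₃ : AdmissibleReq m₃ r₃)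
    (hHn : rH ≠ 7 / 24) (h1fat : r₁ = 7 / 24) (hn2 : r₂ ≠ 7 / 24) (hn3 : r₃ ≠ 7 / 24) :
    max (rH + r₂ + r₃ - 11 / 18) 0 / (g₁ : ℚ) + max (rH + r₁ + r₃ - 11 / 18) 0 / (g₂ : ℚ) +
      max (rH + r₁ + r₂ - 11 / 18) 0 / (g₃ : ℚ) ≤ 11 / 18 - rH := by
  have hHt := hH.le_thin_of_ne hmH2 hHn
  have hH0 := hH.nonneg
  have h2t := h₂.le_thin_of_ne (by omega) hn2
  have h3t := h₃.le_thin_of_ne (by omega) hn3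
  have h20 := h₂.nonneg
  have h30 := h₃.nonneg
  have hm₁eq : m₁ = 2 := h₁.eq_two_of_eq_fat (by omega) h1fat
  have hL₁0 : 0 ≤ max (rH + r₂ + r₃ - 11 / 18) 0 := le_max_right _ _
  have hL₂0 : 0 ≤ max (rH + r₁ + r₃ - 11 / 18) 0 := le_max_right _ _
  have hL₃0 : 0 ≤ max (rH + r₁ + r₂ - 11 / 18) 0 := le_max_right _ _
  have hL₁b : max (rH + r₂ + r₃ - 11 / 18) 0 ≤ 32 / 360 := max_zero_le_of_le (by linarith) (by norm_num)
  have hL₂b : max (rH + r₁ + r₃ - 11 / 18) 0 ≤ 53 / 360 := max_zero_le_of_le (by rw [h1fat]; linarith) (by norm_num)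
  have hL₃b : max (rH + r₁ + r₂ - 11 / 18) 0 ≤ 53 / 360 := max_zero_le_of_le (by rw [h1fat]; linarith) (by norm_num)
  have t₂ := div_nat_le_of_le hL₂0 hL₂b (g := g₂) hg₂1
  have t₃ := div_nat_le_of_le hL₃0 hL₃b (g := g₃) hg₃1
  by_cases hg₁2 : 2 ≤ g₁
  · have t₁ := div_nat_le_half_of_le hL₁0 hL₁b (g := g₁) hg₁2
    linarith
  · -- `g₁ = 1`: `m₂ = m₃ = 2`, `r₂ = r₃ = 0`, every loss vanishes
    have hm₂eq : m₂ = 2 := by omega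
    have hm₃eq : m₃ = 2 := by omega
    have hr₂ : r₂ = 0 := h₂.eq_zero_of_two_of_ne hm₂eq hn2
    have hr₃ : r₃ = 0 := h₃.eq_zero_of_two_of_ne hm₃eq hn3
    have u₁ := div_nat_eq_zero_of_le_zero hL₁0 (max_le (by rw [hr₂, hr₃]; linarith) (le_refl _)) g₁
    have u₂ := div_nat_eq_zero_of_le_zero hL₂0 (max_le (by rw [h1fat, hr₃]; linarith) (le_refl _)) g₂
    have u₃ := div_nat_eq_zero_of_le_zero hL₃0 (max_le (by rw [h1fat, hr₂]; linarith) (le_refl _)) g₃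
    rw [u₁, u₂, u₃]
    linarith

/-- CASE B″: no fat member at all. -/
theorem caseOne_finite_check_nofat (hg₁1 : 1 ≤ g₁) (hg₂1 : 1 ≤ g₂) (hg₃1 : 1 ≤ g₃)
    (hmH2 : 2 ≤ mH) (hm₁2 : 2 ≤ m₁) (hm₂2 : 2 ≤ m₂) (hm₃2 : 2 ≤ m₃)
    (hH : AdmissibleReq mH rH) (h₁ : AdmissibleReq m₁ r₁) (h₂ : AdmissibleReq m₂ r₂) (h₃ : AdmissibleReq m₃ r₃)
    (hHn : rH ≠ 7 / 24) (hn1 : r₁ ≠ 7 / 24) (hn2 : r₂ ≠ 7 / 24) (hn3 : r₃ ≠ 7 / 24) :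
    max (rH + r₂ + r₃ - 11 / 18) 0 / (g₁ : ℚ) + max (rH + r₁ + r₃ - 11 / 18) 0 / (g₂ : ℚ) +
      max (rH + r₁ + r₂ - 11 / 18) 0 / (g₃ : ℚ) ≤ 11 / 18 - rH := by
  have hHt := hH.le_thin_of_ne hmH2 hHn
  have h1t := h₁.le_thin_of_ne hm₁2 hn1
  have h2t := h₂.le_thin_of_ne hm₂2 hn2
  have h3t := h₃.le_thin_of_ne hm₃2 hn3
  have hL₁0 : 0 ≤ max (rH + r₂ + r₃ - 11 / 18) 0 := le_max_right _ _
  have hL₂0 : 0 ≤ max (rH + r₁ + r₃ - 11 / 18) 0 := le_max_right _ _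
  have hL₃0 : 0 ≤ max (rH + r₁ + r₂ - 11 / 18) 0 := le_max_right _ _
  have hL₁b : max (rH + r₂ + r₃ - 11 / 18) 0 ≤ 32 / 360 := max_zero_le_of_le (by linarith) (by norm_num)
  have hL₂b : max (rH + r₁ + r₃ - 11 / 18) 0 ≤ 32 / 360 := max_zero_le_of_le (by linarith) (by norm_num)
  have hL₃b : max (rH + r₁ + r₂ - 11 / 18) 0 ≤ 32 / 360 := max_zero_le_of_le (by linarith) (by norm_num)
  have t₁ := div_nat_le_of_le hL₁0 hL₁b (g := g₁) hg₁1
  have t₂ := div_nat_le_of_le hL₂0 hL₂b (g := g₂) hg₂1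
  have t₃ := div_nat_le_of_le hL₃0 hL₃b (g := g₃) hg₃1
  linarith

set_option maxHeartbeats 800000 in
/-- **THE CASE-1 FINITE CHECK** in the type-count model: with `m_H, m_a, g_a` the counts above and admissible requests,
at most one of which is the fat request `7/24`, the three losses split over the good points fit in the capacity. -/
theorem caseOne_finite_check
    (hmH : mH = 1 + (z₀ + z₁ + z₂ + z₃ + zA)) (hZ : 1 ≤ z₀ + z₁ + z₂ + z₃ + zA)
    (hm₁ : m₁ = 2 + (n₀ + n₂ + n₃) + (z₀ + z₂ + z₃)) (hm₂ : m₂ = 2 + (n₀ + n₁ + n₃) + (z₀ + z₁ + z₃))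
    (hm₃ : m₃ = 2 + (n₀ + n₁ + n₂) + (z₀ + z₁ + z₂))
    (hg₁ : g₁ = 1 + n₁ + n₀ + (z₀ + z₁ + z₂ + z₃)) (hg₂ : g₂ = 1 + n₂ + n₀ + (z₀ + z₁ + z₂ + z₃))
    (hg₃ : g₃ = 1 + n₃ + n₀ + (z₀ + z₁ + z₂ + z₃))
    (hH : AdmissibleReq mH rH) (h₁ : AdmissibleReq m₁ r₁) (h₂ : AdmissibleReq m₂ r₂) (h₃ : AdmissibleReq m₃ r₃)
    (hfat : (rH = 7 / 24 → r₁ ≠ 7 / 24 ∧ r₂ ≠ 7 / 24 ∧ r₃ ≠ 7 / 24) ∧ (r₁ = 7 / 24 → r₂ ≠ 7 / 24 ∧ r₃ ≠ 7 / 24) ∧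
      (r₂ = 7 / 24 → r₃ ≠ 7 / 24)) :
    max (rH + r₂ + r₃ - 11 / 18) 0 / (g₁ : ℚ) + max (rH + r₁ + r₃ - 11 / 18) 0 / (g₂ : ℚ) +
      max (rH + r₁ + r₂ - 11 / 18) 0 / (g₃ : ℚ) ≤ 11 / 18 - rH := by
  have hmH2 : 2 ≤ mH := by omega
  by_cases hHfat : rH = 7 / 24
  · obtain ⟨hn1, hn2, hn3⟩ := hfat.1 hHfat
    exact caseOne_finite_check_fatH hmH hZ hm₁ hm₂ hm₃ hg₁ hg₂ hg₃ hH h₁ h₂ h₃ hHfat hn1 hn2 hn3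
  by_cases h1fat : r₁ = 7 / 24
  · obtain ⟨hn2, hn3⟩ := hfat.2.1 h1fat
    exact caseOne_finite_check_fat₁ hm₁ hm₂ hm₃ hg₁ (by omega) (by omega) hmH2 hH h₁ h₂ h₃ hHfat h1fat hn2 hn3
  by_cases h2fat : r₂ = 7 / 24
  · have hn3 := hfat.2.2 h2fat
    -- rename `1 ↔ 2`
    have h := caseOne_finite_check_fat₁ (n₀ := n₀) (n₁ := n₂) (n₂ := n₁) (n₃ := n₃) (z₀ := z₀) (z₁ := z₂) (z₂ := z₁)
      (z₃ := z₃) (m₁ := m₂) (m₂ := m₁) (m₃ := m₃) (g₁ := g₂) (g₂ := g₁) (g₃ := g₃) (mH := mH) (rH := rH)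
      (r₁ := r₂) (r₂ := r₁) (r₃ := r₃) (by omega) (by omega) (by omega) (by omega) (by omega) (by omega) hmH2
      hH h₂ h₁ h₃ hHfat h2fat h1fat hn3
    have e₃ : max (rH + r₂ + r₁ - 11 / 18) 0 = max (rH + r₁ + r₂ - 11 / 18) 0 := by rw [add_right_comm]
    rw [e₃] at h
    linarith
  by_cases h3fat : r₃ = 7 / 24
  · -- rename `1 ↔ 3`
    have h := caseOne_finite_check_fat₁ (n₀ := n₀) (n₁ := n₃) (n₂ := n₂) (n₃ := n₁) (z₀ := z₀) (z₁ := z₃) (z₂ := z₂)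
      (z₃ := z₁) (m₁ := m₃) (m₂ := m₂) (m₃ := m₁) (g₁ := g₃) (g₂ := g₂) (g₃ := g₁) (mH := mH) (rH := rH)
      (r₁ := r₃) (r₂ := r₂) (r₃ := r₁) (by omega) (by omega) (by omega) (by omega) (by omega) (by omega) hmH2
      hH h₃ h₂ h₁ hHfat h3fat h2fat h1fat
    have e₁ : max (rH + r₂ + r₁ - 11 / 18) 0 = max (rH + r₁ + r₂ - 11 / 18) 0 := by rw [add_right_comm]
    have e₂ : max (rH + r₃ + r₁ - 11 / 18) 0 = max (rH + r₁ + r₃ - 11 / 18) 0 := by rw [add_right_comm]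
    have e₃ : max (rH + r₃ + r₂ - 11 / 18) 0 = max (rH + r₂ + r₃ - 11 / 18) 0 := by rw [add_right_comm]
    rw [e₁, e₂, e₃] at h
    linarith
  exact caseOne_finite_check_nofat (by omega) (by omega) (by omega) hmH2 (by omega) (by omega) (by omega)
    hH h₁ h₂ h₃ hHfat h1fat h2fat h3fat

end Count

end PercRepro.Shadow
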